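import Summits.QuantumFields.YangMills.Theorems.UnitScaleTiltFluctuationComparisonRegPrRestrictedSandwich
import HarnessLib

/-!
# Route `UnitScaleTilt` — crux `FluctuationComparisonRegPrL` (stmt-QuantumFields-19935), STUB 3′ conjunct (A) `RepAtHeights`:
# THE ADAPTER THRESHOLDS DISCHARGED UNIFORMLY IN THE FAMILY (support file `--supports stmt-QuantumFields-19935`)

Fleet seat `ym-ust-19201-p1` (gen 5), 2026-08-27.  Every consumer-side form of conjunct (A) in the tree —
`RepAtHeightsAdapter.dataT3c_repAtHeights_of_trivMass_le_one` (p503038), `AlphaInputsT3AC.OfV2At.repAtHeights_dataT3c_of_haarCompat` (p504281),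
`AlphaInputsT3AC.OfV2At.repAtHeights_dataT3c_of_fibre55Triv` (p505372 — ADOPTED by OWNER RULING g18-№3 as the (A) composition of the re-based
skeleton v5i, modulo the datum rename `dataT3c ↦ dataT3v3` of the commissioned v3 socket) — ends with the SAME threshold hypotheses at a FIXED
family `F` and coupling `γ`: `ε₀ ≤ a₀`, `∀ n, θBal F.L γ 𝔠.b₀ 𝔠.p₀ n ≤ a₁`, `∀ n, 𝔠.B₃·θBal … n ≤ ε₀`, `∀ n, 4·θBal … n < ε₀`.  The crux's quantifier
order (v5h/v5i: `… ∀ ε₀ ∈ (0, ε₁], ∃ γ₁ > 0, ∀ (F : T3Family) (γ : ℝ) (hF : F.L = L), 0 < γ → γ ≤ γ₁ → …`) chooses `γ₁` BEFORE the family, so the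
(A)-closer needs the thresholds in the form «for the record `𝔠 : AlphaConsts L N` and every `a₁, ε₀ > 0` there is `γ₁ ∈ (0, (min 𝔠.γ₀ 1)²]` such
that for EVERY `γ ∈ (0, γ₁]` and every distance `n` all three inequalities hold for `θBal L γ 𝔠.b₀ 𝔠.p₀ n`» — uniform in the family because `θBal`
sees it only through the block size `L` (`T3Thresholds.exists_gamma_forall_θBal_le` / `exists_gamma_forall_mul_θBal_le`, uniform even in
`L ≥ 1`); the clause `γ₁ ≤ (min 𝔠.γ₀ 1)²` is the side condition `hγ1` under which the lane's datum exists.  This file proves exactly that, in the two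
shapes the landed (A)-theorems consume (one conjunction `hth` as in p503038 / three separate families `ha₁ hlo h4` as in p504281, p505372).  It is
PACKAGE-INDEPENDENT (only `AlphaConsts` and `θBal` occur), hence valid verbatim for the v3 datum.  Use: `obtain ⟨γ₁, hγ₁, hγ₁le, hth⟩ :=
RepAtHeightsAdapter.exists_gamma_thresholds 𝔠 ha₁ hε` before `intro F hF`, then `subst hF` (the record casts `hF ▸ 𝔠` reduce) and feed `hth γ hγ ‹γ ≤ γ₁›`.
Nothing of Bałaban's is asserted; standard axioms. [cite: Balaban1985Variational, Thm 1 p.279; Balaban1985UV3, (7) p.257]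
-/

set_option autoImplicit false

noncomputable section

namespace Summit.QuantumFields.YangMills.Theorems.RepAtHeightsAdapter

open Literature.MathematicalPhysics.QuantumFieldTheory.Balaban1983to89
open Literature.MathematicalPhysics.QuantumFieldTheory.Balaban1983to89.T3UnitScaleTilt (θBal)
open Literature.MathematicalPhysics.QuantumFieldTheory.Balaban1983to89.T3Thresholds
open Summit.QuantumFields.Balaban3D.Proofs.Primitives

section Thresholds

variable {L N : ℕ} (𝔠 : AlphaConsts L N)

/-- **THE ADAPTER THRESHOLDS OF CONJUNCT (A), UNIFORMLY IN THE FAMILY** (conjunction form, the `hth` of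
`dataT3c_repAtHeights_of_trivMass_le_one`): for a constants record `𝔠` of block size `L` and any `a₁ > 0`, `ε₀ > 0` there is `γ₁ > 0` with
`γ₁ ≤ (min 𝔠.γ₀ 1)²` such that for every coupling `0 < γ ≤ γ₁` and every distance `n` from the unit scale,
`θBal L γ 𝔠.b₀ 𝔠.p₀ n ≤ a₁ ∧ 𝔠.B₃·θBal L γ 𝔠.b₀ 𝔠.p₀ n ≤ ε₀ ∧ 4·θBal L γ 𝔠.b₀ 𝔠.p₀ n < ε₀` — print's «γ sufficiently small» for the
hypotheses `ε₁ ≤ a₁`, `B₃ε₁ ≤ ε₀` of [Balaban1985Variational] Thm 1 at `ε₁ = θ(n)`, and the route's `4θ < ε₀` of `regPr_of_plaqSmall`.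
[cite: Balaban1985Variational, Thm 1 p.279] -/
theorem exists_gamma_thresholds {a₁ ε₀ : ℝ} (ha₁ : 0 < a₁) (hε : 0 < ε₀) :
    ∃ γ₁ : ℝ, 0 < γ₁ ∧ γ₁ ≤ (min 𝔠.gamma0 1) ^ 2 ∧
      ∀ γ : ℝ, 0 < γ → γ ≤ γ₁ → ∀ n : ℕ,
        θBal L γ 𝔠.b₀ 𝔠.p₀ n ≤ a₁ ∧ 𝔠.B₃ * θBal L γ 𝔠.b₀ 𝔠.p₀ n ≤ ε₀ ∧ 4 * θBal L γ 𝔠.b₀ 𝔠.p₀ n < ε₀ := by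
  have hL : 1 ≤ L := le_of_lt 𝔠.one_lt_L
  obtain ⟨γa, hγa, -, ha⟩ := exists_gamma_forall_θBal_le (b₀ := 𝔠.b₀) (p₀ := 𝔠.p₀) 𝔠.b₀_pos 𝔠.p₀_pos ha₁
  obtain ⟨γb, hγb, -, hb⟩ :=
    exists_gamma_forall_mul_θBal_le (b₀ := 𝔠.b₀) (p₀ := 𝔠.p₀) 𝔠.b₀_pos 𝔠.p₀_pos 𝔠.B₃_pos.le hε
  obtain ⟨γc, hγc, -, hc⟩ :=
    exists_gamma_forall_mul_θBal_le (b₀ := 𝔠.b₀) (p₀ := 𝔠.p₀) 𝔠.b₀_pos 𝔠.p₀_pos (by norm_num : (0 : ℝ) ≤ 8) (half_pos hε)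
  have hg0 : 0 < (min 𝔠.gamma0 1) ^ 2 := pow_pos (lt_min 𝔠.gamma0_pos one_pos) 2
  refine ⟨min (min γa γb) (min γc ((min 𝔠.gamma0 1) ^ 2)),
    lt_min (lt_min hγa hγb) (lt_min hγc hg0), (min_le_right _ _).trans (min_le_right _ _), ?_⟩
  intro γ hγ hγ₁ n
  have hγa' : γ ≤ γa := hγ₁.trans ((min_le_left _ _).trans (min_le_left _ _))
  have hγb' : γ ≤ γb := hγ₁.trans ((min_le_left _ _).trans (min_le_right _ _))
  have hγc' : γ ≤ γc := hγ₁.trans ((min_le_right _ _).trans (min_le_left _ _))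
  refine ⟨ha L hL γ hγ hγa' n, hb L hL γ hγ hγb' n, ?_⟩
  have h8 : 8 * θBal L γ 𝔠.b₀ 𝔠.p₀ n ≤ ε₀ / 2 := hc L hL γ hγ hγc' n
  linarith

/-- The same thresholds as THREE separate families (the hypotheses `ha₁`/`hlo`/`h4` of `repAtHeights_dataT3c_of_haarCompat` /
`repAtHeights_dataT3c_of_fibre55Triv` / `repAtHeights_dataT3c_of_upperRows`, and of their v3 twins). [cite: Balaban1985Variational, Thm 1 p.279] -/
theorem exists_gamma_thresholds₃ {a₁ ε₀ : ℝ} (ha₁ : 0 < a₁) (hε : 0 < ε₀) :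
    ∃ γ₁ : ℝ, 0 < γ₁ ∧ γ₁ ≤ (min 𝔠.gamma0 1) ^ 2 ∧
      ∀ γ : ℝ, 0 < γ → γ ≤ γ₁ →
        (∀ n : ℕ, θBal L γ 𝔠.b₀ 𝔠.p₀ n ≤ a₁) ∧ (∀ n : ℕ, 𝔠.B₃ * θBal L γ 𝔠.b₀ 𝔠.p₀ n ≤ ε₀) ∧
          ∀ n : ℕ, 4 * θBal L γ 𝔠.b₀ 𝔠.p₀ n < ε₀ := by
  obtain ⟨γ₁, hγ₁, hle, h⟩ := exists_gamma_thresholds 𝔠 ha₁ hε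
  exact ⟨γ₁, hγ₁, hle, fun γ hγ hγγ₁ =>
    ⟨fun n => (h γ hγ hγγ₁ n).1, fun n => (h γ hγ hγγ₁ n).2.1, fun n => (h γ hγ hγγ₁ n).2.2⟩⟩

end Thresholds

end Summit.QuantumFields.YangMills.Theorems.RepAtHeightsAdapter

end
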